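import Mathlib.Algebra.BigOperators.Group.Finset.Basic
import Mathlib.Algebra.Order.BigOperators.Group.Finset
import Mathlib.Data.Finset.Lattice.Fold
import Mathlib.Data.Fintype.Basic
import Mathlib.Logic.Function.Basic
import Mathlib.Tactic.Ring
import HarnessLib

/-!
# [OURS · L1 W4.2] Toric marked monomial objects in dimension 3 — the combinatorial (ray-id) model of the corner puzzle

[OURS · L1 W4.2 · seat res-L1-s42-pv-2 gen 5] replaces the role of the «global toric model / height-fan puzzle» of the
σ-design cell inside `stub_Wtop_elimination` (CHAIN w42 v3.16, ELIMINATION LINE v1 (E4-corner); idea-2 card M / res-type-022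
`…Corridor3SigmaCornerPuzzle(Core)`, row `IdeasL1Idea2R8.InitialCornerSolvable`); NOT a statement of the manuscript under review
([Hironaka2017] is a CANDIDATE, never a premise), nor of [CossartJannsenSaito2020], [Spivakovsky1983] or [Blanco 2012].  AI work,
weaker than expert review.

## What this file is

The corner puzzle of a W-top position `A` (the boards of all torus-fixed corners of the successive blow-ups of
`y^m + Σ_{v∈A} λ_v x^{m v}` in legal `T`-invariant centres) is, move for move, the **E-resolution problem of a marked MONOMIAL ideal
on a smooth toric threefold** (a «binomial basic object along `E`» with monomial ideal, in the language of Encinas–Villamayor as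
adapted by R. Blanco, *Desingularization of binomial varieties in arbitrary characteristic* I–II, 2012; literature POINTER only, nothing
is imported or asserted from it).  Its dynamics is purely combinatorial and RAY-INTRINSIC: every ray `r` of the fan carries, for every
generator `v`, an integer exponent `a_r(v)` (`= m·(⟨v,r⟩ − b(r))` in the heights dictionary of card M); a maximal cone is a 3-set of rays;
the blow-up of the face `R` creates ONE new ray `ρ_R` with `a_ρ(v) = Σ_{r∈R} a_r(v) − m` shared by all cones containing `R`, each of which
is replaced by its `|R|` children `(C ∖ {x}) ∪ {ρ_R}`, `x ∈ R`; the face is LEGAL iff `Σ_{r∈R} a_r(v) ≥ m` for every `v` (the centre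
`V(y, x_R)` lies in the multiplicity-`m` locus); a corner is E-RESOLVED iff some generator has `Σ_{r∈C} a_r(v) < m` (order dropped).

This file fixes that model with ABSTRACT ray names (`ℕ`, a fresh id per blow-up; a face of cardinality one is «renamed», which in
the heights dictionary is the height shift `b ↦ b + 1` of a surface blow-up): `TState`, `faceSum`, `IsFace`, `Legal`, `Resolved`,
`EResolved`, `children`, `move`, `Play`, `EResolvable`, the well-formedness / non-negativity invariants, the ray minimum `beta`
(full toric factorisation `J = M·I`) and `Principal` cones (the Encinas–Villamayor monomial case).  No vectors, no heights, no fan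
geometry: the bridge to `IdeasL1Idea2R8.cornerPuzzle` (rays named by their vectors) is a separate file and needs the fan property of
reachable stages.  Every `theorem` here is a small structural lemma, fully proved; there is no `sorry` and no new axiom.

## What is deliberately NOT here

The resolution procedure and its termination (files `…ToricMarkedMonomialCase`, `…ToricMarkedPhase…`), the dictionary to
`HCone.board` / `coord`, and any claim about schemes.
-/

set_option linter.dupNamespace false -- mandated namespace of this single-conjunct summit

namespace Summit.ResolutionOfSingularities.ResolutionOfSingularities.Theorems.CampaignW42.Toric

open Finset

/-- **[OURS · L1 W4.2]** A state of the dimension-3 toric marked monomial object: the maximal cones (3-sets of ray ids), the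
ray-intrinsic exponent table `expo r v = a_r(v)` (generator index `v : ι`), and a fresh-id bound `next`. -/
structure TState (ι : Type) where
  /-- the maximal cones, as finite sets of ray ids -/
  cones : Finset (Finset ℕ)
  /-- `expo r v` = the exponent of the variable of ray `r` in the transform of generator `v` -/
  expo : ℕ → ι → ℤ
  /-- every ray id occurring in a cone is `< next`; the next blow-up names its new ray `next` -/
  next : ℕ

namespace TState

variable {ι : Type}

/-- **[OURS · L1 W4.2]** `Σ_{r ∈ R} a_r(v)`: the order of generator `v` along the torus stratum of the face `R`
(for a maximal cone: the exponent sum at that corner). -/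
def faceSum (s : TState ι) (R : Finset ℕ) (v : ι) : ℤ := ∑ r ∈ R, s.expo r v

/-- **[OURS · L1 W4.2]** `R` is a (non-empty) face of some maximal cone of the state. -/
def IsFace (s : TState ι) (R : Finset ℕ) : Prop := R.Nonempty ∧ ∃ C ∈ s.cones, R ⊆ C

/-- **[OURS · L1 W4.2]** LEGAL centre: a face whose stratum lies in the multiplicity-`m` locus, i.e. every generator has
order `≥ m` along it (`IsPermissible` of the polyhedra game, in exponent form). -/
def Legal (m : ℕ) (s : TState ι) (R : Finset ℕ) : Prop := s.IsFace R ∧ ∀ v, (m : ℤ) ≤ s.faceSum R v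

/-- **[OURS · L1 W4.2]** The corner `C` is E-RESOLVED: some generator has order `< m` there (the marked ideal's singular locus
misses the corner; STRONGER than the puzzle's `Won`, which is `≤ m`). -/
def Resolved (m : ℕ) (s : TState ι) (C : Finset ℕ) : Prop := ∃ v, s.faceSum C v < m

/-- **[OURS · L1 W4.2]** Every corner of the state is E-resolved. -/
def EResolved (m : ℕ) (s : TState ι) : Prop := ∀ C ∈ s.cones, s.Resolved m C

/-- **[OURS · L1 W4.2]** The cones replacing `C` when the face `R` is blown up: untouched if `R ⊄ C`, else the `|R|` children
`(C ∖ {x}) ∪ {ρ}` (`x ∈ R`) with the new ray `ρ = s.next`. -/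
def children (s : TState ι) (R C : Finset ℕ) : Finset (Finset ℕ) :=
  if R ⊆ C then R.image (fun x => insert s.next (C.erase x)) else {C}

/-- **[OURS · L1 W4.2]** The blow-up of the face `R` (heights law / controlled transform of the marked monomial ideal):
the new ray `ρ = s.next` gets `a_ρ(v) = Σ_{r∈R} a_r(v) − m`, every cone containing `R` is replaced by its children. -/
def move (m : ℕ) (s : TState ι) (R : Finset ℕ) : TState ι where
  cones := s.cones.biUnion (s.children R)
  expo := Function.update s.expo s.next (fun v => s.faceSum R v - m)
  next := s.next + 1

/-- **[OURS · L1 W4.2]** `Play m s t`: `t` is reached from `s` by a finite sequence of LEGAL blow-ups. -/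
inductive Play (m : ℕ) : TState ι → TState ι → Prop
  | refl (s : TState ι) : Play m s s
  | step {s t : TState ι} (R : Finset ℕ) : s.Legal m R → Play m (s.move m R) t → Play m s t

/-- **[OURS · L1 W4.2]** The state can be E-resolved by legal blow-ups (order reduction of the marked monomial ideal exists). -/
def EResolvable (m : ℕ) (s : TState ι) : Prop := ∃ t, s.Play m t ∧ t.EResolved m

/-- **[OURS · L1 W4.2]** Well-formed state: cones are 3-sets of already-named rays. -/
def WF (s : TState ι) : Prop := ∀ C ∈ s.cones, C.card = 3 ∧ ∀ r ∈ C, r < s.next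

/-- **[OURS · L1 W4.2]** All exponents are non-negative (true initially, preserved by legal blow-ups). -/
def Nonneg (s : TState ι) : Prop := ∀ r v, 0 ≤ s.expo r v

/-- **[OURS · L1 W4.2]** The initial state of a position: the standard corner `{0,1,2}` with exponent table `a`. -/
def initial (a : Fin 3 → ι → ℤ) : TState ι where
  cones := {{0, 1, 2}}
  expo := fun r v => if h : r < 3 then a ⟨r, h⟩ v else 0
  next := 3

section Beta

variable [Fintype ι] [Nonempty ι]

/-- **[OURS · L1 W4.2]** `β_r := min_v a_r(v)`: the exponent of the variable of ray `r` in the monomial part `M` of the full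
toric factorisation `J = M · I` (every ray treated as exceptional). -/
def beta (s : TState ι) (r : ℕ) : ℤ := Finset.univ.inf' Finset.univ_nonempty (fun v => s.expo r v)

/-- **[OURS · L1 W4.2]** `Σ_{r∈R} β_r`: the order of the monomial part along the face `R`. -/
def betaSum (s : TState ι) (R : Finset ℕ) : ℤ := ∑ r ∈ R, s.beta r

/-- `β_r ≤ a_r(v)` for every generator. -/
theorem beta_le (s : TState ι) (r : ℕ) (v : ι) : s.beta r ≤ s.expo r v :=
  Finset.inf'_le _ (Finset.mem_univ v)

/-- `β_r` is attained by some generator. -/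
theorem exists_beta_eq (s : TState ι) (r : ℕ) : ∃ v, s.beta r = s.expo r v := by
  obtain ⟨v, -, hv⟩ := Finset.exists_mem_eq_inf' (s := (Finset.univ : Finset ι)) Finset.univ_nonempty (fun v => s.expo r v)
  exact ⟨v, hv⟩

/-- The monomial part has order at most that of any generator along a face. -/
theorem betaSum_le_faceSum (s : TState ι) (R : Finset ℕ) (v : ι) : s.betaSum R ≤ s.faceSum R v :=
  Finset.sum_le_sum (fun r _ => s.beta_le r v)

end Beta

/-- **[OURS · L1 W4.2]** The cone `C` is PRINCIPAL: one generator `v₀` has minimal exponent at every ray of `C` (the transform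
of the ideal is generated by a single monomial at that corner — the Encinas–Villamayor «monomial case», `θ(C) = 0`). -/
def Principal (s : TState ι) (C : Finset ℕ) : Prop := ∃ v₀, ∀ v, ∀ r ∈ C, s.expo r v₀ ≤ s.expo r v

/-! ### Structural lemmas -/

/-- With non-negative exponents, orders along faces are monotone in the face. -/
theorem faceSum_mono_of_nonneg {s : TState ι} (hs : s.Nonneg) {R C : Finset ℕ} (h : R ⊆ C) (v : ι) :
    s.faceSum R v ≤ s.faceSum C v :=
  Finset.sum_le_sum_of_subset_of_nonneg h (fun r _ _ => hs r v)

/-- A legal face is never contained in a resolved cone (orders only add up). -/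
theorem not_resolved_of_legal_subset {m : ℕ} {s : TState ι} (hs : s.Nonneg) {R C : Finset ℕ} (hR : s.Legal m R)
    (h : R ⊆ C) : ¬ s.Resolved m C := by
  rintro ⟨v, hv⟩
  have h1 := hR.2 v
  have h2 := faceSum_mono_of_nonneg hs h v
  omega

/-- The cones after a blow-up are the children of the cones before. -/
theorem mem_move_cones {m : ℕ} {s : TState ι} {R D : Finset ℕ} :
    D ∈ (s.move m R).cones ↔ ∃ C ∈ s.cones, D ∈ s.children R C := by
  simp [move]

/-- Children of a cone containing the blown-up face. -/
theorem children_of_subset {s : TState ι} {R C : Finset ℕ} (h : R ⊆ C) :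
    s.children R C = R.image (fun x => insert s.next (C.erase x)) := by
  simp [children, h]

/-- A cone not containing the blown-up face is untouched. -/
theorem children_of_not_subset {s : TState ι} {R C : Finset ℕ} (h : ¬ R ⊆ C) : s.children R C = {C} := by
  simp [children, h]

/-- Old rays keep their exponents (ray-intrinsic data). -/
theorem move_expo_of_ne {m : ℕ} {s : TState ι} {R : Finset ℕ} {r : ℕ} (hr : r ≠ s.next) (v : ι) :
    (s.move m R).expo r v = s.expo r v := by
  simp [move, Function.update_of_ne hr]

/-- The new ray's exponents: `Σ_R a − m`. -/
theorem move_expo_next {m : ℕ} {s : TState ι} {R : Finset ℕ} (v : ι) :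
    (s.move m R).expo s.next v = s.faceSum R v - m := by
  simp [move]

/-- The fresh-id bound advances by one. -/
theorem move_next {m : ℕ} {s : TState ι} {R : Finset ℕ} : (s.move m R).next = s.next + 1 := rfl

/-- Exponent sums of faces avoiding the new ray are unchanged by a blow-up. -/
theorem faceSum_move_of_not_mem {m : ℕ} {s : TState ι} {R D : Finset ℕ} (hD : s.next ∉ D) (v : ι) :
    (s.move m R).faceSum D v = s.faceSum D v := by
  unfold faceSum
  refine Finset.sum_congr rfl (fun r hr => ?_)
  have : r ≠ s.next := fun h => hD (h ▸ hr)
  exact move_expo_of_ne this v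

/-- The exponent sum of a child `(C ∖ {x}) ∪ {ρ}`: the parent's sum, minus the replaced ray, plus the new ray
`Σ_R a − m`. -/
theorem faceSum_child {m : ℕ} {s : TState ι} {R C : Finset ℕ} {x : ℕ} (hx : x ∈ C) (hC : s.next ∉ C) (v : ι) :
    (s.move m R).faceSum (insert s.next (C.erase x)) v = s.faceSum C v - s.expo x v + (s.faceSum R v - m) := by
  unfold faceSum
  have h1 : s.next ∉ C.erase x := fun h => hC (Finset.mem_of_mem_erase h)
  rw [Finset.sum_insert h1, move_expo_next]
  have h2 : ∑ r ∈ C.erase x, (s.move m R).expo r v = ∑ r ∈ C.erase x, s.expo r v :=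
    Finset.sum_congr rfl (fun r hr => move_expo_of_ne (fun h => h1 (h ▸ hr)) v)
  rw [h2, ← Finset.add_sum_erase C (fun r => s.expo r v) hx]
  unfold faceSum
  ring

/-- Legal blow-ups preserve non-negativity of the exponent table. -/
theorem Nonneg.move {m : ℕ} {s : TState ι} (hs : s.Nonneg) {R : Finset ℕ} (hR : s.Legal m R) : (s.move m R).Nonneg := by
  intro r v
  by_cases hr : r = s.next
  · subst hr; rw [move_expo_next]; have := hR.2 v; omega
  · rw [move_expo_of_ne hr]; exact hs r v

/-- Blow-ups preserve well-formedness. -/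
theorem WF.move {m : ℕ} {s : TState ι} (hs : s.WF) (R : Finset ℕ) : (s.move m R).WF := by
  intro D hD
  rw [mem_move_cones] at hD
  obtain ⟨C, hC, hDC⟩ := hD
  obtain ⟨hcard, hlt⟩ := hs C hC
  have hnC : s.next ∉ C := fun h => lt_irrefl _ (hlt _ h)
  by_cases hRC : R ⊆ C
  · rw [children_of_subset hRC, Finset.mem_image] at hDC
    obtain ⟨x, hxR, rfl⟩ := hDC
    have hxC : x ∈ C := hRC hxR
    refine ⟨?_, ?_⟩
    · rw [Finset.card_insert_of_notMem (fun h => hnC (Finset.mem_of_mem_erase h)), Finset.card_erase_of_mem hxC, hcard]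
    · intro r hr
      rw [move_next]
      rcases Finset.mem_insert.mp hr with rfl | hr'
      · exact Nat.lt_succ_self _
      · exact Nat.lt_succ_of_lt (hlt r (Finset.mem_of_mem_erase hr'))
  · rw [children_of_not_subset hRC, Finset.mem_singleton] at hDC
    subst hDC
    exact ⟨hcard, fun r hr => by rw [move_next]; exact Nat.lt_succ_of_lt (hlt r hr)⟩

/-- In a well-formed state the fresh id lies in no cone. -/
theorem WF.next_notMem {s : TState ι} (hs : s.WF) {C : Finset ℕ} (hC : C ∈ s.cones) : s.next ∉ C :=
  fun h => lt_irrefl _ ((hs C hC).2 _ h)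

/-- `Play` is transitive. -/
theorem Play.trans {m : ℕ} {s t u : TState ι} (h₁ : s.Play m t) (h₂ : t.Play m u) : s.Play m u := by
  induction h₁ with
  | refl s => exact h₂
  | step R hR _ ih => exact Play.step R hR (ih h₂)

/-- The initial state of a position is well formed. -/
theorem initial_WF (a : Fin 3 → ι → ℤ) : (initial a).WF := by
  intro C hC
  simp only [initial, Finset.mem_singleton] at hC
  subst hC
  refine ⟨by decide, fun r hr => ?_⟩
  simp only [Finset.mem_insert, Finset.mem_singleton] at hr
  show r < 3
  omega

/-- The initial state of a position with non-negative exponents is non-negative. -/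
theorem initial_nonneg (a : Fin 3 → ι → ℤ) (ha : ∀ k v, 0 ≤ a k v) : (initial a).Nonneg := by
  intro r v
  simp only [initial]
  split_ifs with h
  · exact ha _ _
  · exact le_rfl

end TState

end Summit.ResolutionOfSingularities.ResolutionOfSingularities.Theorems.CampaignW42.Toric
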